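import Summits.Ventures.PercRepro.MSTightPartnerNonemptyCore
import Summits.Ventures.PercRepro.MSTightPartnerNonemptyMirror
import Summits.Ventures.PercRepro.MSTightConjTResidue
import Summits.Ventures.PercRepro.ExcessOneClass

/-!
# A genuine tightening direction has a nonempty partner family; Conjecture (T) in the residue
setting, unconditional

Dossier proofs/MINE1-theoremS.md, Addendum 55. Let `F` have Marica–Schönheim excess one and let
`r` be a tightening direction (`P = proj r F` tight) whose trace is genuine: `∅ ∉ P`, empty core,
`univ.erase r ∉ P`, full support off `r`. Then the partner family `K = partner r F` is NONEMPTY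
(`partner_nonempty_of_genuine`). Proof: with `K = ∅` the trace identity gives `|X ∩ Y| = 1`, both
sides are nonempty, `r` has no twin in `F` (a twin would make the projection injective on `F` and
on `F \\ F`, so `exc(F) = 0`), Theorem (SD) gives `{r} ∈ F \\ F`, i.e. `∅ ∈ Y`, so `X ∩ Y = {∅}`
and every nonempty difference of `P` is monochromatic; the two cases `Rstar P ∈ F₀` / `∈ F₁` are
MSTightPartnerNonemptyCore / Mirror. Twin-freeness of the trace is NOT needed here.

Consequently **Conjecture (T) in the residue setting holds unconditionally**
(`diffsY_subset_diffsX_of_genuine`): `diffsY_subset_diffsX_of_residue` loses its hypothesis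
`(partner r F).Nonempty`.
-/

namespace PercRepro.MSTight

open Finset
open scoped FinsetFamily

variable {α : Type*} [DecidableEq α] [Fintype α]

section Assembly

variable {r : α} {F : Finset (Finset α)}

/-- **(NE).** At a genuine tightening direction of an excess-one family the partner family is
nonempty. -/
theorem partner_nonempty_of_genuine (hF : (F \\ F).card = F.card + 1) (hP : Tight (proj r F))
    (hE : (∅ : Finset α) ∉ proj r F) (hcore : ∀ a, ∃ p ∈ proj r F, a ∉ p)
    (hS : univ.erase r ∉ proj r F) (hsupp : ∀ a, a ≠ r → ∃ p ∈ proj r F, a ∈ p) :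
    (partner r F).Nonempty := by
  by_contra hne
  have hK : partner r F = ∅ := not_nonempty_iff_eq_empty.1 hne
  -- `|X ∩ Y| = 1`
  have hcard : (diffsX r F ∩ diffsY r F).card = 1 := by
    have h := (tight_proj_iff_card_edges hF r).1 hP
    rw [hK, card_empty] at h
    exact h
  obtain ⟨e, he⟩ := card_eq_one.1 hcard
  have heXY : e ∈ diffsX r F ∩ diffsY r F := by
    rw [he]
    exact mem_singleton_self e
  -- both sides are nonempty
  obtain ⟨t, ht, s, hs, -⟩ := mem_diffs.1 (mem_inter.1 heXY).2
  have hin : ∃ t ∈ F, r ∈ t := ⟨insert r t, (mem_partr.1 ht).2, mem_insert_self r t⟩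
  have hout : ∃ t ∈ F, r ∉ t := ⟨s, (mem_part0.1 hs).1, (mem_part0.1 hs).2⟩
  -- `r` has no twin in `F`
  have htw : ∀ b, Twin F r b → b = r := by
    intro b hb
    by_contra hbr
    have h1 := card_proj_of_twin hb.symm hbr
    have h2 := card_diffs_proj_of_twin hb.symm hbr
    have h3 : (proj r F \\ proj r F).card = (proj r F).card := hP
    omega
  -- Theorem (SD): `{r}` is a difference, so `∅ ∈ X ∩ Y`
  have hr : ({r} : Finset α) ∈ F \\ F := singleton_mem_diffs_of_card_diffs_le hF.le htw hin hout
  have h0 : (∅ : Finset α) ∈ diffsX r F ∩ diffsY r F := by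
    refine mem_inter.2 ⟨mem_diffsX_iff.2 ⟨?_, notMem_empty r⟩, mem_diffsY_iff.2 ⟨notMem_empty r, ?_⟩⟩
    · exact mem_diffs.2 ⟨s, (mem_part0.1 hs).1, s, (mem_part0.1 hs).1, Finset.sdiff_self s⟩
    · rw [insert_empty]
      exact hr
  have hXY : diffsX r F ∩ diffsY r F = {∅} := by
    rw [he] at h0 ⊢
    rw [mem_singleton] at h0
    rw [h0]
  have h0Y : (∅ : Finset α) ∈ diffsY r F := (mem_inter.1 h0).2
  -- the two cases of the addable part
  have hρ : Rstar (proj r F) ∈ proj r F :=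
    Rstar_mem_of_dichotomy (dichotomy_of_tight hP) ⟨s, mem_proj_of_mem_part0 hs⟩
  rcases part0_or_partr_of_mem_proj hρ with hρ0 | hρ1
  · exact false_of_Rstar_mem_part0 hP hK hXY hρ0 hE hcore hS hsupp h0Y
  · exact false_of_Rstar_mem_partr hP hK hXY hρ1 hE hcore hS hsupp h0Y

/-- **Conjecture (T) in the residue setting, unconditional.** At a genuine twin-free tightening
direction of an excess-one family every type-I difference is an `r`-free difference:
`diffsY r F ⊆ diffsX r F`. -/
theorem diffsY_subset_diffsX_of_genuine (hF : (F \\ F).card = F.card + 1) (hP : Tight (proj r F))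
    (htf : ∀ a b, Twin (proj r F) a b → a = b)
    (hE : (∅ : Finset α) ∉ proj r F) (hcore : ∀ a, ∃ p ∈ proj r F, a ∉ p)
    (hS : univ.erase r ∉ proj r F) (hsupp : ∀ a, a ≠ r → ∃ p ∈ proj r F, a ∈ p) :
    diffsY r F ⊆ diffsX r F :=
  diffsY_subset_diffsX_of_residue hF hP htf hE hcore hS hsupp
    (partner_nonempty_of_genuine hF hP hE hcore hS hsupp)

/-- A consequence of (T): `X = D(P)` at a genuine twin-free tightening direction (the mechanism of
`diffsX_eq_diffs_proj_of_conjT`, now unconditional). -/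
theorem diffsX_eq_diffs_proj_of_genuine (hF : (F \\ F).card = F.card + 1) (hP : Tight (proj r F))
    (htf : ∀ a b, Twin (proj r F) a b → a = b)
    (hE : (∅ : Finset α) ∉ proj r F) (hcore : ∀ a, ∃ p ∈ proj r F, a ∉ p)
    (hS : univ.erase r ∉ proj r F) (hsupp : ∀ a, a ≠ r → ∃ p ∈ proj r F, a ∈ p) :
    diffsX r F = proj r F \\ proj r F := by
  have hYX := diffsY_subset_diffsX_of_genuine hF hP htf hE hcore hS hsupp
  rw [diffs_proj_eq]
  exact (union_eq_left.2 hYX).symm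

end Assembly

end PercRepro.MSTight
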